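import Summits.Parity.GeneralizedHardyLittlewood.Theorems.PrimeLevelFamEdgeMomentsBeyondDiagonalLayersConvolutionL2
import HarnessLib

/-!
# Route `PrimeLevelFamEdge`, crux K_A `MomentsBeyondDiagonal` (stmt-Parity-20007), line «petersson_layers» v4:
# REGROUPING a separated four-variable form into a BILINEAR form in the products `(u, v) = (m₁m₂, n₁n₂)`

The `k`-th separated form of a truncated layer block (`…LayersTruncatedBlock.truncatedBlock_eq_sum_forms`) is
`Σ_{m₁,n₁,m₂,n₂} A(m₁,m₂)·B(n₁,n₂)·κ(m₁,n₁,m₂,n₂)` with `κ = S(m₁n₁, m₂n₂; c)`.  Wherever the kernel depends on the four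
variables only through the products — `κ(m₁,n₁,m₂,n₂) = K(m₁m₂, n₁n₂)` on the support of `A·B` (for the Kloosterman kernel:
the «good terms» of `…LayersCoprimality` via `kloostermanSum_mul_mul_swap_of_coprime`, or every term after the gcd extraction
`…LayersKloostermanScale` in the residual-dilation variables) — the form IS the bilinear form

  `Σ_{u ≤ X₁X₂} Σ_{v ≤ Y₁Y₂} α_u β_v K(u, v)`,  `α_u = Σ_{m₁m₂ = u} A(m₁,m₂)`, `β_v = Σ_{n₁n₂ = v} B(n₁,n₂)`

(`sum_four_eq_bilinear_fiber`; pure finite combinatorics, generic kernel), whose coefficients are `ℓ²`-controlled by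
`…LayersConvolutionL2` and which `…LayersFourierBound` / `…LayersPascadiBridge` bound.
Proof only (def-free helper); no layer is bounded here; K_A NOT proved; nothing about Landau–Siegel zeros.
-/

noncomputable section

open Finset

namespace Summit.Parity.GeneralizedHardyLittlewood.Theorems.MomentsBeyondDiagonal.Layers

/-- Reordering the four-variable form: `(m₁, n₁, m₂, n₂) → (m₁, m₂, n₁, n₂)`. [folklore] -/
theorem sum_four_comm_middle (S₁ T₁ S₂ T₂ : Finset ℕ) (F : ℕ → ℕ → ℕ → ℕ → ℂ) :
    ∑ m₁ ∈ S₁, ∑ n₁ ∈ T₁, ∑ m₂ ∈ S₂, ∑ n₂ ∈ T₂, F m₁ n₁ m₂ n₂ =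
      ∑ m₁ ∈ S₁, ∑ m₂ ∈ S₂, ∑ n₁ ∈ T₁, ∑ n₂ ∈ T₂, F m₁ n₁ m₂ n₂ :=
  sum_congr rfl fun _ _ ↦ sum_comm

/-- **Kernel replacement on the support**: if `κ = K(m₁m₂, n₁n₂)` wherever `A(m₁,m₂)B(n₁,n₂) ≠ 0`, the form with `κ`
equals the form with `K`. [folklore] -/
theorem sum_four_congr_support (S₁ T₁ S₂ T₂ : Finset ℕ) (A B : ℕ → ℕ → ℂ) (κ : ℕ → ℕ → ℕ → ℕ → ℂ) (K : ℕ → ℕ → ℂ)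
    (hgood : ∀ m₁ ∈ S₁, ∀ m₂ ∈ S₂, ∀ n₁ ∈ T₁, ∀ n₂ ∈ T₂, A m₁ m₂ * B n₁ n₂ ≠ 0 →
      κ m₁ n₁ m₂ n₂ = K (m₁ * m₂) (n₁ * n₂)) :
    ∑ m₁ ∈ S₁, ∑ n₁ ∈ T₁, ∑ m₂ ∈ S₂, ∑ n₂ ∈ T₂, A m₁ m₂ * B n₁ n₂ * κ m₁ n₁ m₂ n₂ =
      ∑ m₁ ∈ S₁, ∑ n₁ ∈ T₁, ∑ m₂ ∈ S₂, ∑ n₂ ∈ T₂, A m₁ m₂ * B n₁ n₂ * K (m₁ * m₂) (n₁ * n₂) := by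
  refine sum_congr rfl fun m₁ hm₁ ↦ sum_congr rfl fun n₁ hn₁ ↦ sum_congr rfl fun m₂ hm₂ ↦ sum_congr rfl fun n₂ hn₂ ↦ ?_
  by_cases h : A m₁ m₂ * B n₁ n₂ = 0
  · rw [h, zero_mul, zero_mul]
  · rw [hgood m₁ hm₁ m₂ hm₂ n₁ hn₁ n₂ hn₂ h]

/-- **The four-variable form as a bilinear form in the products** (kernel already a function of `(m₁m₂, n₁n₂)`):
`Σ_{m₁≤X₁} Σ_{n₁≤Y₁} Σ_{m₂≤X₂} Σ_{n₂≤Y₂} A(m₁,m₂)B(n₁,n₂)K(m₁m₂, n₁n₂) = Σ_{u≤X₁X₂} Σ_{v≤Y₁Y₂} α_u β_v K(u,v)`,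
`α_u = Σ_{m₁m₂=u} A`, `β_v = Σ_{n₁n₂=v} B`. [folklore] -/
theorem sum_four_eq_bilinear_fiber (X₁ X₂ Y₁ Y₂ : ℕ) (A B : ℕ → ℕ → ℂ) (K : ℕ → ℕ → ℂ) :
    ∑ m₁ ∈ Icc 1 X₁, ∑ n₁ ∈ Icc 1 Y₁, ∑ m₂ ∈ Icc 1 X₂, ∑ n₂ ∈ Icc 1 Y₂, A m₁ m₂ * B n₁ n₂ * K (m₁ * m₂) (n₁ * n₂) =
      ∑ u ∈ Icc 1 (X₁ * X₂), ∑ v ∈ Icc 1 (Y₁ * Y₂),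
        (∑ p ∈ (Icc 1 X₁ ×ˢ Icc 1 X₂).filter (fun p : ℕ × ℕ ↦ p.1 * p.2 = u), A p.1 p.2) *
          (∑ p ∈ (Icc 1 Y₁ ×ˢ Icc 1 Y₂).filter (fun p : ℕ × ℕ ↦ p.1 * p.2 = v), B p.1 p.2) * K u v := by
  rw [sum_four_comm_middle]
  -- inner `(n₁, n₂)`-sum → `v`-sum, for each `(m₁, m₂)`
  have hinner : ∀ m₁ m₂ : ℕ,
      ∑ n₁ ∈ Icc 1 Y₁, ∑ n₂ ∈ Icc 1 Y₂, A m₁ m₂ * B n₁ n₂ * K (m₁ * m₂) (n₁ * n₂) =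
        A m₁ m₂ * ∑ v ∈ Icc 1 (Y₁ * Y₂),
          (∑ p ∈ (Icc 1 Y₁ ×ˢ Icc 1 Y₂).filter (fun p : ℕ × ℕ ↦ p.1 * p.2 = v), B p.1 p.2) * K (m₁ * m₂) v := by
    intro m₁ m₂
    rw [← sum_sum_mul_eq_sum_fiber Y₁ Y₂ (fun p : ℕ × ℕ ↦ B p.1 p.2) (fun v ↦ K (m₁ * m₂) v), Finset.mul_sum]
    refine sum_congr rfl fun n₁ _ ↦ ?_
    rw [Finset.mul_sum]
    refine sum_congr rfl fun n₂ _ ↦ ?_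
    ring
  simp_rw [hinner]
  -- outer `(m₁, m₂)`-sum → `u`-sum
  rw [sum_sum_mul_eq_sum_fiber X₁ X₂ (fun p : ℕ × ℕ ↦ A p.1 p.2)
    (fun u ↦ ∑ v ∈ Icc 1 (Y₁ * Y₂),
      (∑ p ∈ (Icc 1 Y₁ ×ˢ Icc 1 Y₂).filter (fun p : ℕ × ℕ ↦ p.1 * p.2 = v), B p.1 p.2) * K u v)]
  refine sum_congr rfl fun u _ ↦ ?_
  rw [Finset.mul_sum]
  refine sum_congr rfl fun v _ ↦ ?_
  ring

/-- **Regrouping under a support hypothesis** (the form met in the layers: kernel `κ(m₁,n₁,m₂,n₂)`, e.g. `S(m₁n₁, m₂n₂; c)`,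
equal to `K(m₁m₂, n₁n₂)`, e.g. `S(m₁m₂, n₁n₂; c)`, on the support of `A·B`). [folklore] -/
theorem sum_four_eq_bilinear_fiber_of_support (X₁ X₂ Y₁ Y₂ : ℕ) (A B : ℕ → ℕ → ℂ) (κ : ℕ → ℕ → ℕ → ℕ → ℂ)
    (K : ℕ → ℕ → ℂ)
    (hgood : ∀ m₁ ∈ Icc 1 X₁, ∀ m₂ ∈ Icc 1 X₂, ∀ n₁ ∈ Icc 1 Y₁, ∀ n₂ ∈ Icc 1 Y₂, A m₁ m₂ * B n₁ n₂ ≠ 0 →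
      κ m₁ n₁ m₂ n₂ = K (m₁ * m₂) (n₁ * n₂)) :
    ∑ m₁ ∈ Icc 1 X₁, ∑ n₁ ∈ Icc 1 Y₁, ∑ m₂ ∈ Icc 1 X₂, ∑ n₂ ∈ Icc 1 Y₂, A m₁ m₂ * B n₁ n₂ * κ m₁ n₁ m₂ n₂ =
      ∑ u ∈ Icc 1 (X₁ * X₂), ∑ v ∈ Icc 1 (Y₁ * Y₂),
        (∑ p ∈ (Icc 1 X₁ ×ˢ Icc 1 X₂).filter (fun p : ℕ × ℕ ↦ p.1 * p.2 = u), A p.1 p.2) *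
          (∑ p ∈ (Icc 1 Y₁ ×ˢ Icc 1 Y₂).filter (fun p : ℕ × ℕ ↦ p.1 * p.2 = v), B p.1 p.2) * K u v := by
  rw [sum_four_congr_support _ _ _ _ A B κ K hgood]
  exact sum_four_eq_bilinear_fiber X₁ X₂ Y₁ Y₂ A B K

end Summit.Parity.GeneralizedHardyLittlewood.Theorems.MomentsBeyondDiagonal.Layers

end
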